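import Literature.MathematicalPhysics.QuantumLattice.TorusSectorPartitionFnTiling
import HarnessLib

/-!
# Blocks of two side lengths tile EVERY large torus: the canonical partition function of the
# `t–t'` Hubbard torus `ℤ/Aℤ × ℤ/Bℤ`, `A = u·a + v·c`, `B = u'·a' + v'·c'`, dominates the product of the
# open-block canonical partition functions, and an open box dominates its sub-boxes

Family `hubbard` (topic `MathematicalPhysics/QuantumLattice`; continuation of `TorusSectorPartitionFnTiling`,
whose blocks all have ONE size `a × b`, so that only the tori `K_x a × K_y b` are covered). Written for the
free-energy route of the `T > 0` certificate family (Hubbard material-oracle programme): its thermodynamic-limit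
producers (`TorusSectorGibbsOpenBoxBound`, `TorusSectorGibbsFillingBoxFreeEnergy`) bind torus limits along
BOX-BUILT tori `L_j = K_j a` only, while the thermal convention of record quantifies over ALL `Ls → ∞`. Writing an
arbitrary side as `L = (K − r)·a + r·(a + 1)` (`L = Ka + r`, `r < a`, `r ≤ K`) removes the restriction, once the
tiling lemma allows strips of TWO widths:

* §1 `prod_partitionFn_twoScale_strips_le` — STRIPS OF TWO WIDTHS: for any two bond sets on
  `Fin (u·a + v·c) ×ₗ Fin b` (first `u` strips of width `a`, then `v` strips of width `c`; strip embeddings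
  `rectCastAdd _ _ b ∘ stripEmb rfl i` and `rectNatAdd _ _ b ∘ stripEmb rfl j` — compositions of the tree's maps,
  no new definition) and any strip sectors, `Π_strips Re Z_β(H|strip; ·) ≤ Re Z_β(H; Σ ·)` (`β ≥ 0`): one
  penalty-free cut at `u·a` (`partitionFn_twoGraph_sector_cut_of_induced`) and the one-width strip lemma on
  each side; `prod_partitionFn_twoScale_columns_le` — the same in the SECOND coordinate (transpose, cut,
  transpose back; column embeddings `rectSwap _ _ ∘ (… ∘ stripEmb rfl j) ∘ rectSwap _ _`).
* §2 `prod_partitionFn_twoScale_blocks_le` — BLOCKS OF FOUR SHAPES `a×a'`, `a×c'`, `c×a'`, `c×c'`: for any two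
  bond sets on `Fin A ×ₗ Fin B`, `A = u·a + v·c`, `B = u'·a' + v'·c'`, the product over all blocks of the
  canonical partition functions of the induced bond sets is at most `Re Z_β(H; Σ sectors)`.
* §3 OFFSET BLOCKS OF THE TORUS ARE OPEN BOXES: a map `Fin w ×ₗ Fin h → Fin A ×ₗ Fin B` of offset form
  `(x, y) ↦ (x₀ + x, y₀ + y)` with `w < A`, `h < B` pulls the torus bond sets back to the open-box bond sets
  (`comap_fermionRectTorusGraph_eq_rectBoxGraph_of_offset`, `…DiagGraph…`; no wrap-around bond inside a block),
  and the four block families of §2 are of offset form; hence **`prod_partitionFn_openBox_twoScale_le_rectTorus`**: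
  `Π_blocks Re Z_β(H^open_{w×h}(t,t',U); a_blk, b_blk) ≤ Re Z_β(H^torus_{A×B}(t,t',U); Σ a_blk, Σ b_blk)` for
  `A = u·a + v·c`, `B = u'·a' + v'·c'` with at least two strips in each direction and positive widths.
* §4 AN OPEN BOX DOMINATES ITS SUB-BOXES at equal particle numbers: `Re Z_β(H^open_{a×h}; p, q) ≤
  Re Z_β(H^open_{(a+d)×h}; p, q)` and `Re Z_β(H^open_{w×a'}; p, q) ≤ Re Z_β(H^open_{w×(a'+d)}; p, q)` (the
  complement carries the vacuum, whose sector partition function is `≥ 1`), so every block of §3 may be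
  replaced by the `a × a'` box: `partitionFn_openBox_swap`, `partitionFn_openBox_mono_fst/_snd`, `partitionFn_openBox_mono`.

Everything is PROVED; no definition, no named fact (the private coordinate bookkeeping of
`HubbardNNNHoppingOpenClusters` / `TorusSectorPartitionFnTiling` is re-derived where needed).

## References

* D. Ruelle, *Statistical Mechanics: Rigorous Results* (1969), §3.3 Prop. 3.3.2 (b) eq. (3.5), 3.3.3 eq. (3.11)
  (sub-additivity over sub-boxes of different sizes), §2.5 (Peierls). [cite: Ruelle1969, §3.3]
* R. B. Israel, *Convexity in the Theory of Lattice Gases* (1979), Lemma II.3.1. [cite: Israel1979, Lemma II.3.1]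
* J. P. F. LeBlanc et al., Phys. Rev. X 5 (2015) 041041, eq. (1) (the `t–t'–U` model and its clusters).
  [cite: LeBlancEtAl2015, eq. (1)]
-/

noncomputable section

namespace Literature.MathematicalPhysics.QuantumLattice

open Matrix Finset HubbardWave0 ThermodynamicLimit LiebThm1
open scoped ComplexOrder BigOperators

variable {Λ : Type*} [LinearOrder Λ] [Fintype Λ] in
/-- Two decidability structures on the same adjacency give the same Hubbard Hamiltonian (re-derived;
private in `TorusSectorPartitionFnTiling`). [folklore] -/
private theorem hamiltonian_congr'' {G₁ G₂ : SimpleGraph Λ} [DecidableRel G₁.Adj] [DecidableRel G₂.Adj]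
    (h : G₁ = G₂) (t U : ℝ) : hamiltonian G₁ t U = hamiltonian G₂ t U := by
  subst h
  congr!

/-! ### §1 Strips of two widths -/

section Strips

open ThermodynamicLimit

variable {b : ℕ}

/-- **Strips of two widths multiply canonical partition functions.** For ANY two bond sets `G, G'` on
`Fin (u·a + v·c) ×ₗ Fin b` — `u` strips of width `a` followed by `v` strips of width `c` — any strip sector
numbers and `β ≥ 0`:
`Π_i Re Z_β(H|strip⁽ᵃ⁾ᵢ; a₁ i, b₁ i) · Π_j Re Z_β(H|strip⁽ᶜ⁾ⱼ; a₂ j, b₂ j) ≤ Re Z_β(H; Σa₁ + Σa₂, Σb₁ + Σb₂)`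
(one penalty-free cut at `u·a`, then the one-width strip lemma on each side). [cite: Ruelle1969, §3.3] -/
theorem prod_partitionFn_twoScale_strips_le (u a v c : ℕ) (t U t' U' : ℝ) {β : ℝ} (hβ : 0 ≤ β)
    (G G' : SimpleGraph (Fin (u * a + v * c) ×ₗ Fin b)) [DecidableRel G.Adj] [DecidableRel G'.Adj]
    (a₁ b₁ : Fin u → ℕ) (a₂ b₂ : Fin v → ℕ) :
    (∏ i, (partitionFn β (spinSectorHamiltonian (a₁ i) (b₁ i)
        (hamiltonian (G.comap (rectCastAdd (u * a) (v * c) b ∘ stripEmb (b := b) rfl i)) t U +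
          hamiltonian (G'.comap (rectCastAdd (u * a) (v * c) b ∘ stripEmb (b := b) rfl i)) t' U'))).re) *
      (∏ j, (partitionFn β (spinSectorHamiltonian (a₂ j) (b₂ j)
        (hamiltonian (G.comap (rectNatAdd (u * a) (v * c) b ∘ stripEmb (b := b) rfl j)) t U +
          hamiltonian (G'.comap (rectNatAdd (u * a) (v * c) b ∘ stripEmb (b := b) rfl j)) t' U'))).re) ≤
      (partitionFn β (spinSectorHamiltonian (∑ i, a₁ i + ∑ j, a₂ j) (∑ i, b₁ i + ∑ j, b₂ j)
        (hamiltonian G t U + hamiltonian G' t' U'))).re := by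
  -- the cut at `u·a`
  set e₁ : (Fin (u * a) ×ₗ Fin b) ↪ (Fin (u * a + v * c) ×ₗ Fin b) :=
    ⟨rectCastAdd (u * a) (v * c) b, (strictMono_rectCastAdd (u * a) (v * c) b).injective⟩ with he₁
  set e₂ : (Fin (v * c) ×ₗ Fin b) ↪ (Fin (u * a + v * c) ×ₗ Fin b) :=
    ⟨rectNatAdd (u * a) (v * c) b, (strictMono_rectNatAdd (u * a) (v * c) b).injective⟩ with he₂
  have hcut := partitionFn_twoGraph_sector_cut_of_induced G G' (e₁ := e₁) (e₂ := e₂)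
    (strictMono_rectCastAdd (u * a) (v * c) b) (strictMono_rectNatAdd (u * a) (v * c) b)
    (rectCastAdd_lt_rectNatAdd (u * a) (v * c) b) (rectCastAdd_cover (u * a) (v * c) b) t U t' U' hβ
    (∑ i, a₁ i) (∑ i, b₁ i) (∑ j, a₂ j) (∑ j, b₂ j)
  have hE₁ : (e₁ : Fin (u * a) ×ₗ Fin b → Fin (u * a + v * c) ×ₗ Fin b) = rectCastAdd (u * a) (v * c) b := rfl
  have hE₂ : (e₂ : Fin (v * c) ×ₗ Fin b → Fin (u * a + v * c) ×ₗ Fin b) = rectNatAdd (u * a) (v * c) b := rfl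
  rw [hE₁, hE₂] at hcut
  -- the one-width strip lemma on each side
  have h1 := prod_partitionFn_strips_le (b := b) a t U t' U' hβ u (u * a) rfl
    (G.comap (rectCastAdd (u * a) (v * c) b)) (G'.comap (rectCastAdd (u * a) (v * c) b)) a₁ b₁
  have h2 := prod_partitionFn_strips_le (b := b) c t U t' U' hβ v (v * c) rfl
    (G.comap (rectNatAdd (u * a) (v * c) b)) (G'.comap (rectNatAdd (u * a) (v * c) b)) a₂ b₂
  simp only [SimpleGraph.comap_comap] at h1 h2
  have h1' : 0 ≤ ∏ i, (partitionFn β (spinSectorHamiltonian (a₁ i) (b₁ i)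
      (hamiltonian (G.comap (rectCastAdd (u * a) (v * c) b ∘ stripEmb (b := b) rfl i)) t U +
        hamiltonian (G'.comap (rectCastAdd (u * a) (v * c) b ∘ stripEmb (b := b) rfl i)) t' U'))).re :=
    Finset.prod_nonneg fun i _ => partitionFn_spinSector_re_nonneg _ _
      ((hamiltonian_isHermitian _ t U).add (hamiltonian_isHermitian _ t' U')) β
  have h2' : 0 ≤ ∏ j, (partitionFn β (spinSectorHamiltonian (a₂ j) (b₂ j)
      (hamiltonian (G.comap (rectNatAdd (u * a) (v * c) b ∘ stripEmb (b := b) rfl j)) t U +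
        hamiltonian (G'.comap (rectNatAdd (u * a) (v * c) b ∘ stripEmb (b := b) rfl j)) t' U'))).re :=
    Finset.prod_nonneg fun j _ => partitionFn_spinSector_re_nonneg _ _
      ((hamiltonian_isHermitian _ t U).add (hamiltonian_isHermitian _ t' U')) β
  exact (mul_le_mul h1 h2 h2' (h1'.trans h1)).trans hcut

/-- **Columns of two heights multiply canonical partition functions** (the second-coordinate form of
`prod_partitionFn_twoScale_strips_le`): for any two bond sets `H, H'` on `Fin w ×ₗ Fin (u'·a' + v'·c')` and the
column embeddings `col⁽ᵃ'⁾ⱼ = rectSwap _ w ∘ (rectCastAdd _ _ w ∘ stripEmb rfl j) ∘ rectSwap w a'`,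
`col⁽ᶜ'⁾ⱼ' = rectSwap _ w ∘ (rectNatAdd _ _ w ∘ stripEmb rfl j') ∘ rectSwap w c'`,
`Π_j Re Z_β(H|col⁽ᵃ'⁾ⱼ; ·) · Π_j' Re Z_β(H|col⁽ᶜ'⁾ⱼ'; ·) ≤ Re Z_β(H; Σ ·)` (transpose, cut, transpose back).
[cite: Ruelle1969, §3.3] -/
theorem prod_partitionFn_twoScale_columns_le (w u' a' v' c' : ℕ) (t U t' U' : ℝ) {β : ℝ} (hβ : 0 ≤ β)
    (H H' : SimpleGraph (Fin w ×ₗ Fin (u' * a' + v' * c'))) [DecidableRel H.Adj] [DecidableRel H'.Adj]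
    (a₁ b₁ : Fin u' → ℕ) (a₂ b₂ : Fin v' → ℕ) :
    (∏ j, (partitionFn β (spinSectorHamiltonian (a₁ j) (b₁ j)
        (hamiltonian (H.comap (rectSwap (u' * a' + v' * c') w ∘
            (rectCastAdd (u' * a') (v' * c') w ∘ stripEmb (b := w) rfl j) ∘ rectSwap w a')) t U +
          hamiltonian (H'.comap (rectSwap (u' * a' + v' * c') w ∘
            (rectCastAdd (u' * a') (v' * c') w ∘ stripEmb (b := w) rfl j) ∘ rectSwap w a')) t' U'))).re) *
      (∏ j, (partitionFn β (spinSectorHamiltonian (a₂ j) (b₂ j)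
        (hamiltonian (H.comap (rectSwap (u' * a' + v' * c') w ∘
            (rectNatAdd (u' * a') (v' * c') w ∘ stripEmb (b := w) rfl j) ∘ rectSwap w c')) t U +
          hamiltonian (H'.comap (rectSwap (u' * a' + v' * c') w ∘
            (rectNatAdd (u' * a') (v' * c') w ∘ stripEmb (b := w) rfl j) ∘ rectSwap w c')) t' U'))).re) ≤
      (partitionFn β (spinSectorHamiltonian (∑ j, a₁ j + ∑ j, a₂ j) (∑ j, b₁ j + ∑ j, b₂ j)
        (hamiltonian H t U + hamiltonian H' t' U'))).re := by
  -- transpose the big graph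
  rw [← partitionFn_spinSector_twoGraph_comap_rectSwap H H']
  have h := prod_partitionFn_twoScale_strips_le (b := w) u' a' v' c' t U t' U' hβ
    (H.comap (rectSwap (u' * a' + v' * c') w)) (H'.comap (rectSwap (u' * a' + v' * c') w)) a₁ b₁ a₂ b₂
  simp only [SimpleGraph.comap_comap] at h
  -- transpose each piece back
  refine le_trans (le_of_eq ?_) h
  congr 1
  · refine Finset.prod_congr rfl fun j _ => ?_
    rw [← partitionFn_spinSector_twoGraph_comap_rectSwap
      (H.comap (rectSwap (u' * a' + v' * c') w ∘
        (rectCastAdd (u' * a') (v' * c') w ∘ stripEmb (b := w) rfl j) ∘ rectSwap w a'))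
      (H'.comap (rectSwap (u' * a' + v' * c') w ∘
        (rectCastAdd (u' * a') (v' * c') w ∘ stripEmb (b := w) rfl j) ∘ rectSwap w a'))]
    simp only [SimpleGraph.comap_comap]
    rfl
  · refine Finset.prod_congr rfl fun j _ => ?_
    rw [← partitionFn_spinSector_twoGraph_comap_rectSwap
      (H.comap (rectSwap (u' * a' + v' * c') w ∘
        (rectNatAdd (u' * a') (v' * c') w ∘ stripEmb (b := w) rfl j) ∘ rectSwap w c'))
      (H'.comap (rectSwap (u' * a' + v' * c') w ∘
        (rectNatAdd (u' * a') (v' * c') w ∘ stripEmb (b := w) rfl j) ∘ rectSwap w c'))]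
    simp only [SimpleGraph.comap_comap]
    rfl

end Strips

/-! ### §2 Blocks of four shapes -/

section Blocks

open ThermodynamicLimit

/-- **Blocks of four shapes multiply canonical partition functions.** For ANY two bond sets `G, G'` on
`Fin (u·a + v·c) ×ₗ Fin (u'·a' + v'·c')`, block sector numbers for the four block families (`a × a'`,
`a × c'`, `c × a'`, `c × c'`; block embeddings = row strip ∘ column strip, compositions of the tree's
`rectCastAdd`/`rectNatAdd`/`stripEmb`/`rectSwap`) and `β ≥ 0`: the product over all blocks of
`Re Z_β(H|block; a_blk, b_blk)` is at most `Re Z_β(H; Σ a_blk, Σ b_blk)` (strips of two widths in the first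
coordinate, then columns of two heights inside every strip). [cite: Ruelle1969, §3.3] -/
theorem prod_partitionFn_twoScale_blocks_le (u a v c u' a' v' c' : ℕ) (t U t' U' : ℝ) {β : ℝ} (hβ : 0 ≤ β)
    (G G' : SimpleGraph (Fin (u * a + v * c) ×ₗ Fin (u' * a' + v' * c')))
    [DecidableRel G.Adj] [DecidableRel G'.Adj]
    (aLL bLL : Fin u → Fin u' → ℕ) (aLU bLU : Fin u → Fin v' → ℕ)
    (aUL bUL : Fin v → Fin u' → ℕ) (aUU bUU : Fin v → Fin v' → ℕ) :
    (∏ i, ∏ j, (partitionFn β (spinSectorHamiltonian (aLL i j) (bLL i j)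
        (hamiltonian (G.comap ((rectCastAdd (u * a) (v * c) (u' * a' + v' * c') ∘
            stripEmb (b := u' * a' + v' * c') rfl i) ∘
            (rectSwap (u' * a' + v' * c') a ∘
              (rectCastAdd (u' * a') (v' * c') a ∘ stripEmb (b := a) rfl j) ∘ rectSwap a a'))) t U +
          hamiltonian (G'.comap ((rectCastAdd (u * a) (v * c) (u' * a' + v' * c') ∘
            stripEmb (b := u' * a' + v' * c') rfl i) ∘
            (rectSwap (u' * a' + v' * c') a ∘
              (rectCastAdd (u' * a') (v' * c') a ∘ stripEmb (b := a) rfl j) ∘ rectSwap a a'))) t' U'))).re) *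
    (∏ i, ∏ j, (partitionFn β (spinSectorHamiltonian (aLU i j) (bLU i j)
        (hamiltonian (G.comap ((rectCastAdd (u * a) (v * c) (u' * a' + v' * c') ∘
            stripEmb (b := u' * a' + v' * c') rfl i) ∘
            (rectSwap (u' * a' + v' * c') a ∘
              (rectNatAdd (u' * a') (v' * c') a ∘ stripEmb (b := a) rfl j) ∘ rectSwap a c'))) t U +
          hamiltonian (G'.comap ((rectCastAdd (u * a) (v * c) (u' * a' + v' * c') ∘
            stripEmb (b := u' * a' + v' * c') rfl i) ∘
            (rectSwap (u' * a' + v' * c') a ∘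
              (rectNatAdd (u' * a') (v' * c') a ∘ stripEmb (b := a) rfl j) ∘ rectSwap a c'))) t' U'))).re) *
    ((∏ i, ∏ j, (partitionFn β (spinSectorHamiltonian (aUL i j) (bUL i j)
        (hamiltonian (G.comap ((rectNatAdd (u * a) (v * c) (u' * a' + v' * c') ∘
            stripEmb (b := u' * a' + v' * c') rfl i) ∘
            (rectSwap (u' * a' + v' * c') c ∘
              (rectCastAdd (u' * a') (v' * c') c ∘ stripEmb (b := c) rfl j) ∘ rectSwap c a'))) t U +
          hamiltonian (G'.comap ((rectNatAdd (u * a) (v * c) (u' * a' + v' * c') ∘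
            stripEmb (b := u' * a' + v' * c') rfl i) ∘
            (rectSwap (u' * a' + v' * c') c ∘
              (rectCastAdd (u' * a') (v' * c') c ∘ stripEmb (b := c) rfl j) ∘ rectSwap c a'))) t' U'))).re) *
    (∏ i, ∏ j, (partitionFn β (spinSectorHamiltonian (aUU i j) (bUU i j)
        (hamiltonian (G.comap ((rectNatAdd (u * a) (v * c) (u' * a' + v' * c') ∘
            stripEmb (b := u' * a' + v' * c') rfl i) ∘
            (rectSwap (u' * a' + v' * c') c ∘
              (rectNatAdd (u' * a') (v' * c') c ∘ stripEmb (b := c) rfl j) ∘ rectSwap c c'))) t U +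
          hamiltonian (G'.comap ((rectNatAdd (u * a) (v * c) (u' * a' + v' * c') ∘
            stripEmb (b := u' * a' + v' * c') rfl i) ∘
            (rectSwap (u' * a' + v' * c') c ∘
              (rectNatAdd (u' * a') (v' * c') c ∘ stripEmb (b := c) rfl j) ∘ rectSwap c c'))) t' U'))).re)) ≤
      (partitionFn β (spinSectorHamiltonian
        (∑ i, (∑ j, aLL i j + ∑ j, aLU i j) + ∑ i, (∑ j, aUL i j + ∑ j, aUU i j))
        (∑ i, (∑ j, bLL i j + ∑ j, bLU i j) + ∑ i, (∑ j, bUL i j + ∑ j, bUU i j))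
        (hamiltonian G t U + hamiltonian G' t' U'))).re := by
  -- strips of two widths in the first coordinate
  have hx := prod_partitionFn_twoScale_strips_le (b := u' * a' + v' * c') u a v c t U t' U' hβ G G'
    (fun i => ∑ j, aLL i j + ∑ j, aLU i j) (fun i => ∑ j, bLL i j + ∑ j, bLU i j)
    (fun i => ∑ j, aUL i j + ∑ j, aUU i j) (fun i => ∑ j, bUL i j + ∑ j, bUU i j)
  -- columns of two heights inside every lower strip …
  have hL : ∀ i : Fin u, _ := fun i =>
    prod_partitionFn_twoScale_columns_le a u' a' v' c' t U t' U' hβ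
      (G.comap (rectCastAdd (u * a) (v * c) (u' * a' + v' * c') ∘ stripEmb (b := u' * a' + v' * c') rfl i))
      (G'.comap (rectCastAdd (u * a) (v * c) (u' * a' + v' * c') ∘ stripEmb (b := u' * a' + v' * c') rfl i))
      (aLL i) (bLL i) (aLU i) (bLU i)
  -- … and inside every upper strip
  have hU : ∀ i : Fin v, _ := fun i =>
    prod_partitionFn_twoScale_columns_le c u' a' v' c' t U t' U' hβ
      (G.comap (rectNatAdd (u * a) (v * c) (u' * a' + v' * c') ∘ stripEmb (b := u' * a' + v' * c') rfl i))
      (G'.comap (rectNatAdd (u * a) (v * c) (u' * a' + v' * c') ∘ stripEmb (b := u' * a' + v' * c') rfl i))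
      (aUL i) (bUL i) (aUU i) (bUU i)
  simp only [SimpleGraph.comap_comap] at hL hU
  -- nonnegativity of all factors
  have hnn : ∀ {Λ₀ : Type} [LinearOrder Λ₀] [Fintype Λ₀] (H H' : SimpleGraph Λ₀) [DecidableRel H.Adj]
      [DecidableRel H'.Adj] (p q : ℕ),
      0 ≤ (partitionFn β (spinSectorHamiltonian p q (hamiltonian H t U + hamiltonian H' t' U'))).re := by
    intro Λ₀ _ _ H H' _ _ p q
    exact partitionFn_spinSector_re_nonneg _ _
      ((hamiltonian_isHermitian _ t U).add (hamiltonian_isHermitian _ t' U')) β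
  -- assemble: lower strips
  have hLprod := Finset.prod_le_prod (s := Finset.univ)
    (fun i _ => mul_nonneg (Finset.prod_nonneg fun j _ => hnn _ _ _ _) (Finset.prod_nonneg fun j _ => hnn _ _ _ _))
    (fun i _ => hL i)
  have hUprod := Finset.prod_le_prod (s := Finset.univ)
    (fun i _ => mul_nonneg (Finset.prod_nonneg fun j _ => hnn _ _ _ _) (Finset.prod_nonneg fun j _ => hnn _ _ _ _))
    (fun i _ => hU i)
  rw [Finset.prod_mul_distrib] at hLprod hUprod
  refine le_trans ?_ hx
  exact mul_le_mul hLprod hUprod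
    (mul_nonneg (Finset.prod_nonneg fun i _ => Finset.prod_nonneg fun j _ => hnn _ _ _ _)
      (Finset.prod_nonneg fun i _ => Finset.prod_nonneg fun j _ => hnn _ _ _ _))
    (Finset.prod_nonneg fun i _ => hnn _ _ _ _)

end Blocks

/-! ### §3 Offset blocks of the torus are open boxes -/

section Offset

/-- On the ring `ℤ/Aℤ`, two sites of a window `[x₀, x₀ + w)` with `w < A` are ring-neighbours iff their
positions in the window differ by one (no wrap-around bond inside the window). [folklore] -/
private theorem ringAdj_offset_iff {A x₀ w : ℕ} (hw : w < A) (x x' : Fin w) (hx : x₀ + x < A)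
    (hx' : x₀ + x' < A) : ringAdj A (x₀ + x) (x₀ + x') ↔ lineAdj x x' := by
  unfold ringAdj lineAdj
  have h1 := x.isLt
  have h2 := x'.isLt
  rcases Nat.lt_or_ge (x₀ + x + 1) A with hu | hu
  · rw [Nat.mod_eq_of_lt hu]
    rcases Nat.lt_or_ge (x₀ + x' + 1) A with hv | hv
    · rw [Nat.mod_eq_of_lt hv]; omega
    · rw [show x₀ + (x' : ℕ) + 1 = A by omega, Nat.mod_self]; omega
  · rw [show x₀ + (x : ℕ) + 1 = A by omega, Nat.mod_self]
    rcases Nat.lt_or_ge (x₀ + x' + 1) A with hv | hv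
    · rw [Nat.mod_eq_of_lt hv]; omega
    · rw [show x₀ + (x' : ℕ) + 1 = A by omega, Nat.mod_self]; omega

/-- Chain adjacency is translation invariant (re-derived; private in `HubbardNNNHoppingOpenClusters`).
[folklore] -/
private theorem lineAdj_add_left_iff' (c u v : ℕ) : lineAdj (c + u) (c + v) ↔ lineAdj u v := by
  unfold lineAdj; omega

/-- **The nearest-neighbour bonds of the torus `A × B` inside an offset window `[x₀, x₀+w) × [y₀, y₀+h)`,
`w < A`, `h < B`, are those of the open `w × h` box**: for every map `f` of offset form
`(x, y) ↦ (x₀ + x, y₀ + y)`, `(fermionRectTorusGraph A B).comap f = rectBoxGraph w h`. [cite: Ruelle1969, §3.3] -/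
theorem comap_fermionRectTorusGraph_eq_rectBoxGraph_of_offset {w h A B : ℕ} (hwA : w < A) (hhB : h < B)
    (f : Fin w ×ₗ Fin h → Fin A ×ₗ Fin B) (x₀ y₀ : ℕ)
    (hf1 : ∀ p, ((ofLex (f p)).1 : ℕ) = x₀ + (ofLex p).1)
    (hf2 : ∀ p, ((ofLex (f p)).2 : ℕ) = y₀ + (ofLex p).2) :
    (fermionRectTorusGraph A B).comap f = rectBoxGraph w h := by
  ext p q
  rw [SimpleGraph.comap_adj, fermionRectTorusGraph_adj_iff]
  have e1 : (ofLex (f p)).1 = (ofLex (f q)).1 ↔ (ofLex p).1 = (ofLex q).1 := by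
    rw [← Fin.val_inj, hf1, hf1, add_right_inj, Fin.val_inj]
  have e2 : (ofLex (f p)).2 = (ofLex (f q)).2 ↔ (ofLex p).2 = (ofLex q).2 := by
    rw [← Fin.val_inj, hf2, hf2, add_right_inj, Fin.val_inj]
  have e3 : ringAdj A (ofLex (f p)).1 (ofLex (f q)).1 ↔ lineAdj (ofLex p).1 (ofLex q).1 := by
    have hp := (ofLex (f p)).1.isLt
    have hq := (ofLex (f q)).1.isLt
    rw [hf1] at hp ⊢
    rw [hf1] at hq ⊢
    exact ringAdj_offset_iff hwA _ _ hp hq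
  have e4 : ringAdj B (ofLex (f p)).2 (ofLex (f q)).2 ↔ lineAdj (ofLex p).2 (ofLex q).2 := by
    have hp := (ofLex (f p)).2.isLt
    have hq := (ofLex (f q)).2.isLt
    rw [hf2] at hp ⊢
    rw [hf2] at hq ⊢
    exact ringAdj_offset_iff hhB _ _ hp hq
  rw [e1, e2, e3, e4]
  rfl

/-- **The diagonal bonds of the torus inside an offset window are those of the open box** (`w < A`,
`h < B`). [cite: Ruelle1969, §3.3] -/
theorem comap_fermionRectTorusDiagGraph_eq_rectBoxDiagGraph_of_offset {w h A B : ℕ} (hwA : w < A)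
    (hhB : h < B) (f : Fin w ×ₗ Fin h → Fin A ×ₗ Fin B) (x₀ y₀ : ℕ)
    (hf1 : ∀ p, ((ofLex (f p)).1 : ℕ) = x₀ + (ofLex p).1)
    (hf2 : ∀ p, ((ofLex (f p)).2 : ℕ) = y₀ + (ofLex p).2) :
    (fermionRectTorusDiagGraph A B).comap f = rectBoxDiagGraph w h := by
  ext p q
  rw [SimpleGraph.comap_adj, fermionRectTorusDiagGraph_adj_iff]
  have e3 : ringAdj A (ofLex (f p)).1 (ofLex (f q)).1 ↔ lineAdj (ofLex p).1 (ofLex q).1 := by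
    have hp := (ofLex (f p)).1.isLt
    have hq := (ofLex (f q)).1.isLt
    rw [hf1] at hp ⊢
    rw [hf1] at hq ⊢
    exact ringAdj_offset_iff hwA _ _ hp hq
  have e4 : ringAdj B (ofLex (f p)).2 (ofLex (f q)).2 ↔ lineAdj (ofLex p).2 (ofLex q).2 := by
    have hp := (ofLex (f p)).2.isLt
    have hq := (ofLex (f q)).2.isLt
    rw [hf2] at hp ⊢
    rw [hf2] at hq ⊢
    exact ringAdj_offset_iff hhB _ _ hp hq
  rw [e3, e4]
  rfl

/-- The bonds of an OPEN box inside an offset window are those of the small open box (no size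
condition). [cite: Ruelle1969, §3.3] -/
theorem comap_rectBoxGraph_eq_rectBoxGraph_of_offset {w h A B : ℕ}
    (f : Fin w ×ₗ Fin h → Fin A ×ₗ Fin B) (x₀ y₀ : ℕ)
    (hf1 : ∀ p, ((ofLex (f p)).1 : ℕ) = x₀ + (ofLex p).1)
    (hf2 : ∀ p, ((ofLex (f p)).2 : ℕ) = y₀ + (ofLex p).2) :
    (rectBoxGraph A B).comap f = rectBoxGraph w h := by
  ext p q
  rw [SimpleGraph.comap_adj]
  show (((ofLex (f p)).2 = (ofLex (f q)).2 ∧ lineAdj (ofLex (f p)).1 (ofLex (f q)).1) ∨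
      ((ofLex (f p)).1 = (ofLex (f q)).1 ∧ lineAdj (ofLex (f p)).2 (ofLex (f q)).2)) ↔
    (((ofLex p).2 = (ofLex q).2 ∧ lineAdj (ofLex p).1 (ofLex q).1) ∨
      ((ofLex p).1 = (ofLex q).1 ∧ lineAdj (ofLex p).2 (ofLex q).2))
  have e1 : (ofLex (f p)).1 = (ofLex (f q)).1 ↔ (ofLex p).1 = (ofLex q).1 := by
    rw [← Fin.val_inj, hf1, hf1, add_right_inj, Fin.val_inj]
  have e2 : (ofLex (f p)).2 = (ofLex (f q)).2 ↔ (ofLex p).2 = (ofLex q).2 := by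
    rw [← Fin.val_inj, hf2, hf2, add_right_inj, Fin.val_inj]
  rw [e1, e2, hf1, hf1, hf2, hf2, lineAdj_add_left_iff', lineAdj_add_left_iff']

/-- The diagonal bonds of an OPEN box inside an offset window are those of the small open box.
[cite: Ruelle1969, §3.3] -/
theorem comap_rectBoxDiagGraph_eq_rectBoxDiagGraph_of_offset {w h A B : ℕ}
    (f : Fin w ×ₗ Fin h → Fin A ×ₗ Fin B) (x₀ y₀ : ℕ)
    (hf1 : ∀ p, ((ofLex (f p)).1 : ℕ) = x₀ + (ofLex p).1)
    (hf2 : ∀ p, ((ofLex (f p)).2 : ℕ) = y₀ + (ofLex p).2) :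
    (rectBoxDiagGraph A B).comap f = rectBoxDiagGraph w h := by
  ext p q
  rw [SimpleGraph.comap_adj]
  show (lineAdj (ofLex (f p)).1 (ofLex (f q)).1 ∧ lineAdj (ofLex (f p)).2 (ofLex (f q)).2) ↔
    (lineAdj (ofLex p).1 (ofLex q).1 ∧ lineAdj (ofLex p).2 (ofLex q).2)
  rw [hf1, hf1, hf2, hf2, lineAdj_add_left_iff', lineAdj_add_left_iff']

end Offset

/-! ### §3b Open boxes of four shapes inside the torus -/

section OpenBoxes

open ThermodynamicLimit

/-- **Open boxes of two side lengths per direction tile the torus** (finite-temperature cluster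
variational principle on `ℤ/Aℤ × ℤ/Bℤ` with `A = u·a + v·c`, `B = u'·a' + v'·c'`, `u, u' ≥ 2`, `a, a' ≥ 1`;
canonical ensemble, `β ≥ 0`): for any block sector numbers,
`Π Re Z_β(H^open_{a×a'}; ·) · Π Re Z_β(H^open_{a×c'}; ·) · (Π Re Z_β(H^open_{c×a'}; ·) · Π Re Z_β(H^open_{c×c'}; ·))
 ≤ Re Z_β(H^torus_{A×B}; Σ ·)` with `H^open = hubbardOpenBoxTT' _ _ t t' U`,
`H^torus = hubbardRectTorusTT' A B t t' U` — every large torus, not only `K a × K a`, is covered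
(`L = (K − r)·a + r·(a+1)`). [cite: Ruelle1969, §3.3] [cite: LeBlancEtAl2015, eq. (1)] -/
theorem prod_partitionFn_openBox_twoScale_le_rectTorus (u a v c u' a' v' c' : ℕ) (hu : 2 ≤ u)
    (hu' : 2 ≤ u') (ha : 1 ≤ a) (ha' : 1 ≤ a') (t t' U : ℝ) {β : ℝ} (hβ : 0 ≤ β)
    (aLL bLL : Fin u → Fin u' → ℕ) (aLU bLU : Fin u → Fin v' → ℕ)
    (aUL bUL : Fin v → Fin u' → ℕ) (aUU bUU : Fin v → Fin v' → ℕ) :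
    (∏ i, ∏ j, (partitionFn β (spinSectorHamiltonian (aLL i j) (bLL i j) (hubbardOpenBoxTT' a a' t t' U))).re) *
    (∏ i, ∏ j, (partitionFn β (spinSectorHamiltonian (aLU i j) (bLU i j) (hubbardOpenBoxTT' a c' t t' U))).re) *
    ((∏ i, ∏ j, (partitionFn β (spinSectorHamiltonian (aUL i j) (bUL i j)
        (hubbardOpenBoxTT' c a' t t' U))).re) *
      (∏ i, ∏ j, (partitionFn β (spinSectorHamiltonian (aUU i j) (bUU i j)
        (hubbardOpenBoxTT' c c' t t' U))).re)) ≤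
      (partitionFn β (spinSectorHamiltonian
        (∑ i, (∑ j, aLL i j + ∑ j, aLU i j) + ∑ i, (∑ j, aUL i j + ∑ j, aUU i j))
        (∑ i, (∑ j, bLL i j + ∑ j, bLU i j) + ∑ i, (∑ j, bUL i j + ∑ j, bUU i j))
        (hubbardRectTorusTT' (u * a + v * c) (u' * a' + v' * c') t t' U))).re := by
  have h := prod_partitionFn_twoScale_blocks_le u a v c u' a' v' c' t U t' 0 hβ
    (fermionRectTorusGraph (u * a + v * c) (u' * a' + v' * c'))
    (fermionRectTorusDiagGraph (u * a + v * c) (u' * a' + v' * c')) aLL bLL aLU bLU aUL bUL aUU bUU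
  refine le_trans (le_of_eq ?_) h
  -- side lengths versus torus sizes
  have hxa : a < u * a + v * c := by nlinarith
  have hya : a' < u' * a' + v' * c' := by nlinarith
  have hxc : ∀ i : Fin v, c < u * a + v * c := fun i => by
    have hv : 1 ≤ v := Nat.one_le_of_lt i.pos
    nlinarith
  have hyc : ∀ j : Fin v', c' < u' * a' + v' * c' := fun j => by
    have hv : 1 ≤ v' := Nat.one_le_of_lt j.pos
    nlinarith
  refine congrArg₂ (· * ·) (congrArg₂ (· * ·) ?_ ?_) (congrArg₂ (· * ·) ?_ ?_)
  · refine Finset.prod_congr rfl fun i _ => Finset.prod_congr rfl fun j _ => ?_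
    have hf1 : ∀ p : Fin a ×ₗ Fin a', ((ofLex (((rectCastAdd (u * a) (v * c) (u' * a' + v' * c') ∘
        stripEmb (b := u' * a' + v' * c') rfl i) ∘ (rectSwap (u' * a' + v' * c') a ∘
          (rectCastAdd (u' * a') (v' * c') a ∘ stripEmb (b := a) rfl j) ∘ rectSwap a a')) p)).1 : ℕ) =
        (i : ℕ) * a + (ofLex p).1 := fun p => rfl
    have hf2 : ∀ p : Fin a ×ₗ Fin a', ((ofLex (((rectCastAdd (u * a) (v * c) (u' * a' + v' * c') ∘
        stripEmb (b := u' * a' + v' * c') rfl i) ∘ (rectSwap (u' * a' + v' * c') a ∘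
          (rectCastAdd (u' * a') (v' * c') a ∘ stripEmb (b := a) rfl j) ∘ rectSwap a a')) p)).2 : ℕ) =
        (j : ℕ) * a' + (ofLex p).2 := fun p => rfl
    rw [hubbardOpenBoxTT', hamiltonian_congr'' (comap_fermionRectTorusGraph_eq_rectBoxGraph_of_offset hxa hya
      _ _ _ hf1 hf2), hamiltonian_congr'' (comap_fermionRectTorusDiagGraph_eq_rectBoxDiagGraph_of_offset
      hxa hya _ _ _ hf1 hf2)]
  · refine Finset.prod_congr rfl fun i _ => Finset.prod_congr rfl fun j _ => ?_
    have hf1 : ∀ p : Fin a ×ₗ Fin c', ((ofLex (((rectCastAdd (u * a) (v * c) (u' * a' + v' * c') ∘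
        stripEmb (b := u' * a' + v' * c') rfl i) ∘ (rectSwap (u' * a' + v' * c') a ∘
          (rectNatAdd (u' * a') (v' * c') a ∘ stripEmb (b := a) rfl j) ∘ rectSwap a c')) p)).1 : ℕ) =
        (i : ℕ) * a + (ofLex p).1 := fun p => rfl
    have hf2 : ∀ p : Fin a ×ₗ Fin c', ((ofLex (((rectCastAdd (u * a) (v * c) (u' * a' + v' * c') ∘
        stripEmb (b := u' * a' + v' * c') rfl i) ∘ (rectSwap (u' * a' + v' * c') a ∘
          (rectNatAdd (u' * a') (v' * c') a ∘ stripEmb (b := a) rfl j) ∘ rectSwap a c')) p)).2 : ℕ) =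
        (u' * a' + (j : ℕ) * c') + (ofLex p).2 := fun p => by
      rw [add_assoc]; rfl
    rw [hubbardOpenBoxTT', hamiltonian_congr'' (comap_fermionRectTorusGraph_eq_rectBoxGraph_of_offset hxa
      (hyc j) _ _ _ hf1 hf2), hamiltonian_congr''
      (comap_fermionRectTorusDiagGraph_eq_rectBoxDiagGraph_of_offset hxa (hyc j) _ _ _ hf1 hf2)]
  · refine Finset.prod_congr rfl fun i _ => Finset.prod_congr rfl fun j _ => ?_
    have hf1 : ∀ p : Fin c ×ₗ Fin a', ((ofLex (((rectNatAdd (u * a) (v * c) (u' * a' + v' * c') ∘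
        stripEmb (b := u' * a' + v' * c') rfl i) ∘ (rectSwap (u' * a' + v' * c') c ∘
          (rectCastAdd (u' * a') (v' * c') c ∘ stripEmb (b := c) rfl j) ∘ rectSwap c a')) p)).1 : ℕ) =
        (u * a + (i : ℕ) * c) + (ofLex p).1 := fun p => by
      rw [add_assoc]; rfl
    have hf2 : ∀ p : Fin c ×ₗ Fin a', ((ofLex (((rectNatAdd (u * a) (v * c) (u' * a' + v' * c') ∘
        stripEmb (b := u' * a' + v' * c') rfl i) ∘ (rectSwap (u' * a' + v' * c') c ∘
          (rectCastAdd (u' * a') (v' * c') c ∘ stripEmb (b := c) rfl j) ∘ rectSwap c a')) p)).2 : ℕ) =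
        (j : ℕ) * a' + (ofLex p).2 := fun p => rfl
    rw [hubbardOpenBoxTT', hamiltonian_congr'' (comap_fermionRectTorusGraph_eq_rectBoxGraph_of_offset (hxc i)
      hya _ _ _ hf1 hf2), hamiltonian_congr''
      (comap_fermionRectTorusDiagGraph_eq_rectBoxDiagGraph_of_offset (hxc i) hya _ _ _ hf1 hf2)]
  · refine Finset.prod_congr rfl fun i _ => Finset.prod_congr rfl fun j _ => ?_
    have hf1 : ∀ p : Fin c ×ₗ Fin c', ((ofLex (((rectNatAdd (u * a) (v * c) (u' * a' + v' * c') ∘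
        stripEmb (b := u' * a' + v' * c') rfl i) ∘ (rectSwap (u' * a' + v' * c') c ∘
          (rectNatAdd (u' * a') (v' * c') c ∘ stripEmb (b := c) rfl j) ∘ rectSwap c c')) p)).1 : ℕ) =
        (u * a + (i : ℕ) * c) + (ofLex p).1 := fun p => by
      rw [add_assoc]; rfl
    have hf2 : ∀ p : Fin c ×ₗ Fin c', ((ofLex (((rectNatAdd (u * a) (v * c) (u' * a' + v' * c') ∘
        stripEmb (b := u' * a' + v' * c') rfl i) ∘ (rectSwap (u' * a' + v' * c') c ∘
          (rectNatAdd (u' * a') (v' * c') c ∘ stripEmb (b := c) rfl j) ∘ rectSwap c c')) p)).2 : ℕ) =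
        (u' * a' + (j : ℕ) * c') + (ofLex p).2 := fun p => by
      rw [add_assoc]; rfl
    rw [hubbardOpenBoxTT', hamiltonian_congr'' (comap_fermionRectTorusGraph_eq_rectBoxGraph_of_offset (hxc i)
      (hyc j) _ _ _ hf1 hf2), hamiltonian_congr''
      (comap_fermionRectTorusDiagGraph_eq_rectBoxDiagGraph_of_offset (hxc i) (hyc j) _ _ _ hf1 hf2)]

end OpenBoxes

/-! ### §4 An open box dominates its sub-boxes -/

section Monotone

open ThermodynamicLimit

/-- The coordinate swap carries the open `w × h` box onto the open `h × w` box (nearest-neighbour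
bonds). [folklore] -/
private theorem comap_rectSwap_rectBoxGraph (w h : ℕ) :
    (rectBoxGraph w h).comap (rectSwap h w) = rectBoxGraph h w := by
  ext p q
  rw [SimpleGraph.comap_adj]
  show (((ofLex p).1 = (ofLex q).1 ∧ lineAdj (ofLex p).2 (ofLex q).2) ∨
      ((ofLex p).2 = (ofLex q).2 ∧ lineAdj (ofLex p).1 (ofLex q).1)) ↔
    (((ofLex p).2 = (ofLex q).2 ∧ lineAdj (ofLex p).1 (ofLex q).1) ∨
      ((ofLex p).1 = (ofLex q).1 ∧ lineAdj (ofLex p).2 (ofLex q).2))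
  exact Or.comm

/-- The coordinate swap carries the open `w × h` box onto the open `h × w` box (diagonal bonds).
[folklore] -/
private theorem comap_rectSwap_rectBoxDiagGraph (w h : ℕ) :
    (rectBoxDiagGraph w h).comap (rectSwap h w) = rectBoxDiagGraph h w := by
  ext p q
  rw [SimpleGraph.comap_adj]
  show (lineAdj (ofLex p).2 (ofLex q).2 ∧ lineAdj (ofLex p).1 (ofLex q).1) ↔
    (lineAdj (ofLex p).1 (ofLex q).1 ∧ lineAdj (ofLex p).2 (ofLex q).2)
  exact And.comm

/-- **Transposition invariance of the open-box canonical partition functions**: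
`Z_β(H^open_{h×w}; p, q) = Z_β(H^open_{w×h}; p, q)`. [cite: LeBlancEtAl2015, eq. (1)] -/
theorem partitionFn_openBox_swap (w h : ℕ) (t t' U β : ℝ) (p q : ℕ) :
    partitionFn β (spinSectorHamiltonian p q (hubbardOpenBoxTT' h w t t' U)) =
      partitionFn β (spinSectorHamiltonian p q (hubbardOpenBoxTT' w h t t' U)) := by
  have hs := partitionFn_spinSector_twoGraph_comap_rectSwap (rectBoxGraph w h) (rectBoxDiagGraph w h)
    t U t' 0 β p q
  rw [hamiltonian_congr'' (comap_rectSwap_rectBoxGraph w h),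
    hamiltonian_congr'' (comap_rectSwap_rectBoxDiagGraph w h)] at hs
  exact hs

/-- **An open box dominates its sub-box in the first direction** at equal particle numbers:
`Re Z_β(H^open_{a×h}; p, q) ≤ Re Z_β(H^open_{(a+d)×h}; p, q)` (`β ≥ 0`; the complementary `d × h` box carries the
vacuum, whose sector partition function is `≥ 1`). [cite: Ruelle1969, §3.3] -/
theorem partitionFn_openBox_mono_fst (a d h : ℕ) (t t' U : ℝ) {β : ℝ} (hβ : 0 ≤ β) (p q : ℕ) :
    (partitionFn β (spinSectorHamiltonian p q (hubbardOpenBoxTT' a h t t' U))).re ≤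
      (partitionFn β (spinSectorHamiltonian p q (hubbardOpenBoxTT' (a + d) h t t' U))).re := by
  set e₁ : (Fin a ×ₗ Fin h) ↪ (Fin (a + d) ×ₗ Fin h) :=
    ⟨rectCastAdd a d h, (strictMono_rectCastAdd a d h).injective⟩ with he₁
  set e₂ : (Fin d ×ₗ Fin h) ↪ (Fin (a + d) ×ₗ Fin h) :=
    ⟨rectNatAdd a d h, (strictMono_rectNatAdd a d h).injective⟩ with he₂
  have hcut := partitionFn_twoGraph_sector_cut_of_induced (rectBoxGraph (a + d) h)
    (rectBoxDiagGraph (a + d) h) (e₁ := e₁) (e₂ := e₂) (strictMono_rectCastAdd a d h)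
    (strictMono_rectNatAdd a d h) (rectCastAdd_lt_rectNatAdd a d h) (rectCastAdd_cover a d h) t U t' 0 hβ
    p q 0 0
  have hE₁ : (e₁ : Fin a ×ₗ Fin h → Fin (a + d) ×ₗ Fin h) = rectCastAdd a d h := rfl
  have hE₂ : (e₂ : Fin d ×ₗ Fin h → Fin (a + d) ×ₗ Fin h) = rectNatAdd a d h := rfl
  rw [hE₁, hE₂, add_zero, add_zero] at hcut
  have hf1 : ∀ x : Fin a ×ₗ Fin h, ((ofLex (rectCastAdd a d h x)).1 : ℕ) = 0 + (ofLex x).1 := fun x => by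
    rw [zero_add]; rfl
  have hf2 : ∀ x : Fin a ×ₗ Fin h, ((ofLex (rectCastAdd a d h x)).2 : ℕ) = 0 + (ofLex x).2 := fun x => by
    rw [zero_add]; rfl
  rw [hamiltonian_congr'' (comap_rectBoxGraph_eq_rectBoxGraph_of_offset _ _ _ hf1 hf2),
    hamiltonian_congr'' (comap_rectBoxDiagGraph_eq_rectBoxDiagGraph_of_offset _ _ _ hf1 hf2)] at hcut
  have hvac := one_le_partitionFn_spinSector_zero_re ((rectBoxGraph (a + d) h).comap (rectNatAdd a d h))
    ((rectBoxDiagGraph (a + d) h).comap (rectNatAdd a d h)) t U t' 0 β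
  have hZ : 0 ≤ (partitionFn β (spinSectorHamiltonian p q (hubbardOpenBoxTT' a h t t' U))).re :=
    partitionFn_spinSector_re_nonneg _ _ (hubbardOpenBoxTT'_isHermitian a h t t' U) β
  unfold hubbardOpenBoxTT' at hZ ⊢
  calc (partitionFn β (spinSectorHamiltonian p q
        (hamiltonian (rectBoxGraph a h) t U + hamiltonian (rectBoxDiagGraph a h) t' 0))).re
      = (partitionFn β (spinSectorHamiltonian p q
        (hamiltonian (rectBoxGraph a h) t U + hamiltonian (rectBoxDiagGraph a h) t' 0))).re * 1 :=
        (mul_one _).symm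
    _ ≤ _ := mul_le_mul_of_nonneg_left hvac hZ
    _ ≤ _ := hcut

/-- **An open box dominates its sub-box in the second direction**:
`Re Z_β(H^open_{w×a'}; p, q) ≤ Re Z_β(H^open_{w×(a'+d)}; p, q)` (`β ≥ 0`). [cite: Ruelle1969, §3.3] -/
theorem partitionFn_openBox_mono_snd (w a' d : ℕ) (t t' U : ℝ) {β : ℝ} (hβ : 0 ≤ β) (p q : ℕ) :
    (partitionFn β (spinSectorHamiltonian p q (hubbardOpenBoxTT' w a' t t' U))).re ≤
      (partitionFn β (spinSectorHamiltonian p q (hubbardOpenBoxTT' w (a' + d) t t' U))).re := by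
  rw [partitionFn_openBox_swap a' w, partitionFn_openBox_swap (a' + d) w]
  exact partitionFn_openBox_mono_fst a' d w t t' U hβ p q

/-- **An open box dominates every sub-box** at equal particle numbers:
`Re Z_β(H^open_{a×a'}; p, q) ≤ Re Z_β(H^open_{(a+d)×(a'+d')}; p, q)` (`β ≥ 0`). [cite: Ruelle1969, §3.3] -/
theorem partitionFn_openBox_mono (a d a' d' : ℕ) (t t' U : ℝ) {β : ℝ} (hβ : 0 ≤ β) (p q : ℕ) :
    (partitionFn β (spinSectorHamiltonian p q (hubbardOpenBoxTT' a a' t t' U))).re ≤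
      (partitionFn β (spinSectorHamiltonian p q (hubbardOpenBoxTT' (a + d) (a' + d') t t' U))).re :=
  (partitionFn_openBox_mono_fst a d a' t t' U hβ p q).trans
    (partitionFn_openBox_mono_snd (a + d) a' d' t t' U hβ p q)

end Monotone

end Literature.MathematicalPhysics.QuantumLattice
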